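/-
Copyright (c) 2026 the pub-hodgecm-mathlib formalisation cell (harness21).  Prover seat hodgecm-mathlib-LH4-p14 (g5), req620 Track A «(D-RAM) FOUR-FRAME» squad, unit U2H:
the (ρ2b′-X) child `stub_U2H_fixedPointCensus_typeTwo_unit0` (U2H ED. 15 :418) — the payer's TOKEN BRIDGE for the three typed bottoms (A)(B)(C) (SOCKET-hOC{A,B,C}.v1):
:418's `m`-token in the one-field currency of the welds ((B) lead LH4-p07 (g7) seam (S-tok), (A) LH4-p11 (g5) recipe item 5, (C) LH4-p04 (g5) (C-5a)).  2026-09-04.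
-/
import Summits.HodgeConjecture.HodgeConjecture.Theorems.F0P3cDyRamFixedPointCensusTypeTwoPrelude   -- ★ p857439 (LH4-p14 (g4)): every token of :418 + `valued_toPlace_uniformizer_pow`
import Literature.NumberTheory.Rogawski1990.FinExplicitTransferFactorInertExponent                 -- ★ `eval_finCharpolyTwo_finGammaTwo_apply_eq_quadratic`
import HarnessLib

/-!
# F0 · P3c · line LH4 «(D-RAM) FOUR-FRAME» — unit (ii-H), leaf (ρ2b′-X): THE `m`-TOKEN BRIDGE (the :418 token `|χ_g(u)_w| = |ι_w π_v^m|` in the bottoms' one-field letters)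
(Rogawski 1990 §4.9; Serre 1979 Ch. III §6)

Cell `pub/hodgecm-mathlib`, crux H413 = `stmt-HodgeConjecture-24833` (helper lane, count-neutral); THEOREMS ONLY (no definition, no instance, no notation, no named fact,
no `sorry`), typed under the LINE FILE's `open` block.  Served: the three typed bottom sockets of the (ρ2b′-X) pay chain (★ p857960 `TypeSplit`), whose common antecedent
is :418's depth token `hm : Valued.v ((χ_g.eval u) w) = Valued.v (ι_w π_v ^ m)` (`χ_g = finCharpolyTwo`, `u = finGammaTwo`) while their G-side welds (★ `toricCensusSum_unr_weld_of_frame`,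
★ `toricCensusSum_ramK_weld`, ★ T5s-RamM) and the depth dictionary ★ p858045 `v_sub_eq_exp_neg_of_token` consume the ONE-FIELD token `|u₀₀² − tr·u₀₀ + det| = exp(−2m)` with
`u₀₀ = ((ι_v γ_H.2)_w : GL₁(L_w)) 0 0`, `tr ∕ det` of `(γ_H.1)_w`.

WHAT IS PROVED (letter plumbing, no mathematics beyond ★ lemmas):
* `finGammaTwo_apply_eq` — `u_w = u₀₀`: `finGammaTwo L v γH w` IS the socket's `((localNonsplitEquiv … γH.2).val : GL (Fin 1) L_w) 0 0` (`rfl`: ★ `coe_localNonsplitEquiv_eq_map`).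
* `eval_finCharpolyTwo_apply_eq_quadratic_socket` — `(χ_g.eval u) w = u₀₀² − tr·u₀₀ + det` in the socket's spelling (★ `eval_finCharpolyTwo_finGammaTwo_apply_eq_quadratic`).
* HEAD `valued_quadratic_of_mtoken` — from :418's `hm`: `Valued.v (u₀₀ ^ 2 − tr * u₀₀ + det) = exp (−(2·m))` (★ Prelude `valued_toPlace_uniformizer_pow`: `|ι_w π_v^m| = exp(−2m)` at
  a ramified `w`) = the `htok` binder of ★ p858045 VERBATIM (with `t := tr`, `D := det`, `u₀ := u₀₀`).

HONEST LABEL: HC_CM is proved only modulo the 7 printed citations (2 remaining named inputs: hLiu418 = stmt-HodgeConjecture-24832, h413 = stmt-HodgeConjecture-24833) until rung 0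
closes; this file is `--supports stmt-HodgeConjecture-24833 --as helper` (count-neutral); it asserts nothing about the sockets.

## References
* [Rogawski1990] J. D. Rogawski, *Automorphic Representations of Unitary Groups in Three Variables*, Ann. of Math. Stud. 123 (1990), §4.9 p. 55, Prop. 4.9.1 (b).
* [Serre1979] J.-P. Serre, *Local Fields*, GTM 67 (1979), Ch. III §6 Prop. 13.
-/

set_option autoImplicit false

noncomputable section

namespace Summit.HodgeConjecture.HodgeConjecture.Cruxes.H413.F0P3cDyRamTokenBridgeCM

-- THE LINES MODULE'S `open` CONTEXT (tree `Cruxes/H413/Lines/F0_P3c_DyRamFourFrame_U2H_HSide.lean`, after its `namespace`):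
open MeasureTheory Measure NumberField IsDedekindDomain Topology Filter
open Literature.NumberTheory.Automorphic Literature.NumberTheory.Automorphic.UnitaryGroup Literature.NumberTheory.Automorphic.IntegralReduction
open Literature.NumberTheory.Rogawski1990 Literature.NumberTheory.GaloisRepresentations
open Literature.NumberTheory.Automorphic.UnitaryThreeFourFrame
open Summit.HodgeConjecture.HodgeConjecture.Cruxes.H413.F0P3cDyRamFourFrameHSideDefs
open Summit.HodgeConjecture.HodgeConjecture.Cruxes.H413.F0P3cDyRamFourFrameHFamilyDefs
open scoped Matrix MatrixGroups Classical ValuativeRel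
open Summit.HodgeConjecture.HodgeConjecture.Cruxes.H413.F0P3cDyRamFourFrameHSideDefsR
open Summit.HodgeConjecture.HodgeConjecture.Cruxes.H413.F0P3cDyRamFourFrameLawDefsR (shiftT shiftR)
open Literature.NumberTheory.Automorphic.UnitaryLatticeTree Literature.NumberTheory.Automorphic.HermitianLattice

variable (L : Type) [Field L] [NumberField L] [IsCMField L]
  {v : HeightOneSpectrum (𝓞 ↥(maximalRealSubfield L))} (w : UnitaryGroup.PlacesOver L v)
  (hw : IsCMField.complexConj L • w.1 = w.1)
  (γH : (UnitaryGroup.cmDatum L 2 (Matrix.of fun i j : Fin 2 => if i.val + j.val + 1 = 2 then (1 : L) else 0)).Local v ×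
    (UnitaryGroup.cmDatum L 1 (Matrix.of fun i j : Fin 1 => if i.val + j.val + 1 = 1 then (1 : L) else 0)).Local v)

/-- **`u_w = u₀₀`**: the `U(1)`-token at `w` IS the `(0,0)` entry of the one-place model of `γ_H.2` (both are `(γ_H.2) 0 0` evaluated at `w`). [cite: Rogawski1990, §4.9 p. 55] -/
theorem finGammaTwo_apply_eq :
    finGammaTwo L v γH w =
      (((localNonsplitEquiv (IsCMField.complexConj L) (Matrix.of fun i j : Fin 1 => if i.val + j.val + 1 = 1 then (1 : L) else 0) (IsCMField.complexConj_ne_one L) w hw γH.2).val :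
          GL (Fin 1) (w.1.adicCompletion L)) : Matrix (Fin 1) (Fin 1) (w.1.adicCompletion L)) 0 0 :=
  rfl

/-- **`χ_g(u)_w = u₀₀² − tr(g_w)·u₀₀ + det(g_w)`** in the sockets' spelling (`g_w = (γ_H.1).map eval_w`). [cite: Rogawski1990, §4.9 p. 55] -/
theorem eval_finCharpolyTwo_apply_eq_quadratic_socket :
    ((finCharpolyTwo L v γH).eval (finGammaTwo L v γH)) w =
      (((localNonsplitEquiv (IsCMField.complexConj L) (Matrix.of fun i j : Fin 1 => if i.val + j.val + 1 = 1 then (1 : L) else 0) (IsCMField.complexConj_ne_one L) w hw γH.2).val :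
          GL (Fin 1) (w.1.adicCompletion L)) : Matrix (Fin 1) (Fin 1) (w.1.adicCompletion L)) 0 0 ^ 2 -
        (((γH.1.val : GL (Fin 2) (UnitaryGroup.LocalRing L v)).val.map (Pi.evalRingHom (fun w' : UnitaryGroup.PlacesOver L v => w'.1.adicCompletion L) w))).trace *
          (((localNonsplitEquiv (IsCMField.complexConj L) (Matrix.of fun i j : Fin 1 => if i.val + j.val + 1 = 1 then (1 : L) else 0) (IsCMField.complexConj_ne_one L) w hw γH.2).val :
            GL (Fin 1) (w.1.adicCompletion L)) : Matrix (Fin 1) (Fin 1) (w.1.adicCompletion L)) 0 0 +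
        (((γH.1.val : GL (Fin 2) (UnitaryGroup.LocalRing L v)).val.map (Pi.evalRingHom (fun w' : UnitaryGroup.PlacesOver L v => w'.1.adicCompletion L) w))).det := by
  rw [← finGammaTwo_apply_eq L w hw γH]
  exact eval_finCharpolyTwo_finGammaTwo_apply_eq_quadratic L v w γH

/-- **THE `m`-TOKEN IN ONE-FIELD CURRENCY**: at a place `w` fixed by complex conjugation with `e(w|v) ≠ 1`, :418's depth token `|χ_g(u)_w| = |ι_w(π_v)^m|` reads
`|u₀₀² − tr·u₀₀ + det| = exp(−2m)` — the `htok` binder of ★ `F0P3cDyRamTypeTwoDepthDictionary.v_sub_eq_exp_neg_of_token` (`t := tr`, `D := det`, `u₀ := u₀₀`).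
[cite: Rogawski1990, §4.9 p. 55, Prop. 4.9.1 (b)] [cite: Serre1979, Ch. III §6 Prop. 13] -/
theorem valued_quadratic_of_mtoken (he : v.asIdeal.ramificationIdx' w.1.asIdeal ≠ 1) {m : ℕ}
    (hm : Valued.v (((finCharpolyTwo L v γH).eval (finGammaTwo L v γH)) w) =
      Valued.v ((toPlace v w (HeckeCharacter.uniformizer ↥(maximalRealSubfield L) v : v.adicCompletion ↥(maximalRealSubfield L))) ^ m)) :
    Valued.v ((((localNonsplitEquiv (IsCMField.complexConj L) (Matrix.of fun i j : Fin 1 => if i.val + j.val + 1 = 1 then (1 : L) else 0) (IsCMField.complexConj_ne_one L) w hw γH.2).val :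
          GL (Fin 1) (w.1.adicCompletion L)) : Matrix (Fin 1) (Fin 1) (w.1.adicCompletion L)) 0 0 ^ 2 -
        (((γH.1.val : GL (Fin 2) (UnitaryGroup.LocalRing L v)).val.map (Pi.evalRingHom (fun w' : UnitaryGroup.PlacesOver L v => w'.1.adicCompletion L) w))).trace *
          (((localNonsplitEquiv (IsCMField.complexConj L) (Matrix.of fun i j : Fin 1 => if i.val + j.val + 1 = 1 then (1 : L) else 0) (IsCMField.complexConj_ne_one L) w hw γH.2).val :
            GL (Fin 1) (w.1.adicCompletion L)) : Matrix (Fin 1) (Fin 1) (w.1.adicCompletion L)) 0 0 +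
        (((γH.1.val : GL (Fin 2) (UnitaryGroup.LocalRing L v)).val.map (Pi.evalRingHom (fun w' : UnitaryGroup.PlacesOver L v => w'.1.adicCompletion L) w))).det) =
      WithZero.exp (-(2 * (m : ℤ))) := by
  rw [← eval_finCharpolyTwo_apply_eq_quadratic_socket L w hw γH, hm]
  exact F0P3cDyRamFixedPointCensusTypeTwoPrelude.valued_toPlace_uniformizer_pow L w hw he m

end Summit.HodgeConjecture.HodgeConjecture.Cruxes.H413.F0P3cDyRamTokenBridgeCM

end
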